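import Mathlib.Algebra.BigOperators.Ring.Finset
import Mathlib.Combinatorics.SimpleGraph.Connectivity.Finite
import Mathlib.Combinatorics.SimpleGraph.Operations
import Literature.Topology.FourManifolds.KhFlipReach
import Literature.Topology.FourManifolds.KhComplex
import Literature.Topology.FourManifolds.KhComplexQDegreeProofs
import HarnessLib

/-!
# The quantum degree along the Lee differential

Bookkeeping for the Khovanov–Lee tower on Gauss diagrams (`KhResolutions → KhComplex →
LeeRasmussen`), continuing `KhFlipReach`:

* the bridge `mergedReach_iff_reachable_sup_edge` identifying `MergedReach Γ a b`
  (`KhFlipReach`) with reachability in `Γ ⊔ edge a b` (twins elsewhere in the tree, not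
  importable here: `Literature.Computability.QuantumComplexity.reachable_sup_edge_iff` in
  `JonesLoopCount`, `reachable_sup_edge_imp` in `RandomClusterFKG`);
* the label `circleLabel s C` of a state circle of an enhanced state, and the quantum degree
  as a sum over state circles (`qDegree_eq_sum_circleLabel`);
* the incidence number made explicit (`incidence_of_flip`: no `Classical.choose`), and its
  consequence for **Lee's theory** `(h, t) = (0, 1)`: a nonzero incidence number changes the
  quantum degree by `0` or `+4` (`qDegree_eq_or_of_incidence_ne_zero`), i.e. Lee's
  differential is the sum of a degree-`0` and a degree-`4` part and preserves `q mod 4`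
  (Lee (2005), §4; Rasmussen (2010), §2.1 and Lemma 3.5: `m' = m + Φ_m`, `Δ' = Δ + Φ_Δ`). The
  circle bookkeeping is the tree's surgery lemma `qDegree_sub_weight_surgery`
  (`KhComplexQDegreeProofs`, proved there for the `h = t = 0` discharge).

## Sources

* E. S. Lee, *An endomorphism of the Khovanov invariant*, Adv. Math. 197 (2005), §4.
* J. Rasmussen, *Khovanov homology and the slice genus*, Invent. Math. 182 (2010), §2.1,
  Lemma 3.5.
* D. Bar-Natan, *On Khovanov's categorification of the Jones polynomial*, AGT 2 (2002), §3.2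
  (gradings).
* Mathlib: `SimpleGraph.ConnectedComponent.lift`, `SimpleGraph.edge`,
  `Finset.natCast_card_filter`.

## Design choices

* Total on `GaussDiagram` (virtual diagrams included), no named fact used: in the one-to-one
  bifurcation case the incidence number is `0` by definition (`KhComplex`), so only merges and
  splits need bookkeeping, which the surgery lemma provides without planarity.
* The degree statement is proved for every commutative ring `R` at `(h, t) = (0, 1)`.
-/

open Function Set

noncomputable section

namespace Literature.Topology.FourManifolds

/-! ## Merged reachability and `Γ ⊔ edge a b` -/

section Abstract

variable {V : Type*} {Γ : SimpleGraph V} {a b : V}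

/-- **Merged reachability is reachability after adding the edge `ab`**: `MergedReach Γ a b u v`
iff `u` and `v` are connected in `Γ ⊔ edge a b` (the bridge to the formulation used elsewhere
in the tree, `reachable_sup_edge_iff` of `JonesLoopCount`). [folklore] -/
theorem mergedReach_iff_reachable_sup_edge (u v : V) :
    MergedReach Γ a b u v ↔ (Γ ⊔ SimpleGraph.edge a b).Reachable u v := by
  have hle : Γ ≤ Γ ⊔ SimpleGraph.edge a b := le_sup_left
  have hab : (Γ ⊔ SimpleGraph.edge a b).Reachable a b := by
    by_cases h : a = b
    · rw [h]
    · refine SimpleGraph.Adj.reachable ?_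
      rw [SimpleGraph.sup_adj, SimpleGraph.edge_adj]
      exact Or.inr ⟨Or.inl ⟨rfl, rfl⟩, h⟩
  constructor
  · rintro (h | ⟨h, h'⟩ | ⟨h, h'⟩)
    · exact h.mono hle
    · exact (h.mono hle).trans (hab.trans (h'.mono hle))
    · exact (h.mono hle).trans (hab.symm.trans (h'.mono hle))
  · refine rel_of_reachable (MergedReach.equivalence Γ a b) (fun u v huv ↦ ?_)
    rw [SimpleGraph.sup_adj, SimpleGraph.edge_adj] at huv
    rcases huv with h | ⟨⟨rfl, rfl⟩ | ⟨rfl, rfl⟩, -⟩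
    · exact MergedReach.of_reachable h.reachable
    · exact MergedReach.left_right Γ _ _
    · exact (MergedReach.left_right Γ _ _).symm

end Abstract

/-! ## The quantum degree as a sum over state circles -/

namespace GaussDiagram

variable {G : GaussDiagram}

/-- The **degree of a label**: the basis vector `1 ↔ false` of the Frobenius algebra has
quantum degree `+1`, the basis vector `X ↔ true` has degree `-1`. Khovanov (2000), §4.3;
Bar-Natan (2002), §3.2. [cite: BarNatan2002, §3.2] -/
def labelDeg (ℓ : Bool) : ℤ := if ℓ = true then -1 else 1

/-- The degree of the label `1` is `+1`. [folklore] -/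
@[simp] theorem labelDeg_false : labelDeg false = 1 := rfl

/-- The degree of the label `X` is `-1`. [folklore] -/
@[simp] theorem labelDeg_true : labelDeg true = -1 := rfl

/-- Negating a label changes its degree by `∓ 2`: `labelDeg (!ℓ) = - labelDeg ℓ`. [folklore] -/
theorem labelDeg_not (ℓ : Bool) : labelDeg (!ℓ) = -labelDeg ℓ := by
  cases ℓ <;> rfl

/-- The **label of a state circle** of an enhanced state (`false ↔ 1`, `true ↔ X`): the common
label of its arcs (`EnhancedState.label_eq`). Viro (2004), §5.1. [cite: Viro2004, §5.1] -/
def circleLabel (s : G.EnhancedState) : G.StateCircle s.state → Bool :=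
  SimpleGraph.ConnectedComponent.lift s.label (fun _ _ p _ ↦ s.label_eq_of_reachable ⟨p⟩)

/-- The label of the circle through an arc is the label of the arc. [folklore] -/
@[simp]
theorem circleLabel_circleOf (s : G.EnhancedState) (v : G.Arc) :
    circleLabel s (G.circleOf s.state v) = s.label v :=
  rfl

/-- A state circle carries an arc with label `ℓ` iff its label is `ℓ` (the predicate used in
`qDegree`). [folklore] -/
theorem exists_circleOf_eq_iff (s : G.EnhancedState) (C : G.StateCircle s.state) (ℓ : Bool) :
    (∃ v, G.circleOf s.state v = C ∧ s.label v = ℓ) ↔ circleLabel s C = ℓ := by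
  induction C using SimpleGraph.ConnectedComponent.ind with | h v₀ => ?_
  change (∃ v, G.circleOf s.state v = G.circleOf s.state v₀ ∧ s.label v = ℓ) ↔ s.label v₀ = ℓ
  constructor
  · rintro ⟨v, hv, rfl⟩
    exact (s.label_eq_of_reachable (SimpleGraph.ConnectedComponent.exact hv)).symm
  · rintro rfl
    exact ⟨v₀, rfl, rfl⟩

/-- **The quantum degree as a sum over circles**:
`qDegree s = Σ_{C} labelDeg (circleLabel s C) + |s| + n₊ - 2 n₋`
(`#(circles labelled 1) - #(circles labelled X)` is the sum of the label degrees).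
Bar-Natan (2002), §3.2. [cite: BarNatan2002, §3.2] -/
theorem qDegree_eq_sum_circleLabel (s : G.EnhancedState) :
    qDegree s = ∑ C, labelDeg (circleLabel s C) + s.state.weight + G.nPlus - 2 * G.nMinus := by
  unfold qDegree
  rw [Finset.natCast_card_filter, Finset.natCast_card_filter, ← Finset.sum_sub_distrib]
  congr 1; congr 1; congr 1
  refine Finset.sum_congr rfl (fun C _ ↦ ?_)
  simp only [exists_circleOf_eq_iff]
  cases circleLabel s C <;> simp

/-! ## The incidence number made explicit -/

section Ring

variable (R : Type) [CommRing R]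

/-- The state reached by flipping a `0`-smoothing determines the flipped chord. [folklore] -/
theorem flip_unique {σ : G.State} {i j : Fin G.n} (hi : σ i = false)
    (h : Function.update σ j true = Function.update σ i true) : j = i := by
  by_contra hji
  have := congrFun h i
  rw [Function.update_of_ne (Ne.symm hji), Function.update_self, hi] at this
  exact Bool.false_ne_true this

/-- **The incidence number of a flip, explicitly.** If `s'.state` is `s.state` with the
`0`-smoothing at chord `i` flipped to `1`, the incidence number `⟨d s, s'⟩` is given by the
merge/split/neither case split of `KhComplex.incidence` *at this chord `i`* (the chord is
unique, `flip_unique`, so no choice is involved). Viro (2004), §5.2. [cite: Viro2004, §5.2] -/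
theorem incidence_of_flip (h t : R) {s s' : G.EnhancedState} {i : Fin G.n}
    (hi : s.state i = false) (hs' : s'.state = Function.update s.state i true) :
    G.incidence R h t s s' =
      if G.IsMergeAt s.state i then
        (if ∀ c, G.circleOf s'.state c ≠ G.circleOf s'.state (G.arcIn (G.overPos i)) →
            s'.label c = s.label c then
          (edgeSign s.state i : R) * mergeCoeff R h t (s.label (G.arcIn (G.overPos i)))
            (s.label (G.arcOut (G.overPos i))) (s'.label (G.arcIn (G.overPos i)))
        else 0)
      else if G.IsSplitAt s.state i then
        (if ∀ c, G.circleOf s.state c ≠ G.circleOf s.state (G.arcIn (G.overPos i)) →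
            s'.label c = s.label c then
          (edgeSign s.state i : R) * splitCoeff R h t (s.label (G.arcIn (G.overPos i)))
            (s'.label (G.arcIn (G.overPos i))) (s'.label (G.arcOut (G.overPos i)))
        else 0)
      else 0 := by
  have hex : ∃ j, s.state j = false ∧ s'.state = Function.update s.state j true := ⟨i, hi, hs'⟩
  unfold incidence
  rw [dif_pos hex]
  have hspec := Classical.choose_spec hex
  have hj : Classical.choose hex = i := flip_unique hi (hspec.2.symm.trans hs')
  simp only [hj]

/-- Without a single `0 → 1` flip relating the states, the incidence number vanishes. [folklore] -/
theorem incidence_of_not_flip (h t : R) {s s' : G.EnhancedState}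
    (hn : ¬ ∃ i, s.state i = false ∧ s'.state = Function.update s.state i true) :
    G.incidence R h t s s' = 0 := by
  unfold incidence
  rw [dif_neg hn]

/-! ## Lee's differential and the quantum degree -/

/-- The nonzero entries of the multiplication table of `ℚ[X]/(X² - 1)` (`h = 0`, `t = 1`):
`1·1 = 1`, `1·X = X·1 = X`, `X·X = 1`. Lee (2005), §4. [cite: Lee2005, §4] -/
theorem mergeCoeff_lee_ne_zero {x y z : Bool} (h0 : mergeCoeff R 0 1 x y z ≠ 0) :
    (x = false ∧ y = false ∧ z = false) ∨ (x = false ∧ y = true ∧ z = true) ∨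
      (x = true ∧ y = false ∧ z = true) ∨ (x = true ∧ y = true ∧ z = false) := by
  cases x <;> cases y <;> cases z <;> simp [mergeCoeff] at h0 ⊢

/-- The nonzero entries of the comultiplication table of `ℚ[X]/(X² - 1)` (`h = 0`, `t = 1`):
`Δ 1 = 1 ⊗ X + X ⊗ 1`, `Δ X = X ⊗ X + 1 ⊗ 1`. Lee (2005), §4. [cite: Lee2005, §4] -/
theorem splitCoeff_lee_ne_zero {x y z : Bool} (h0 : splitCoeff R 0 1 x y z ≠ 0) :
    (x = false ∧ y = false ∧ z = true) ∨ (x = false ∧ y = true ∧ z = false) ∨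
      (x = true ∧ y = true ∧ z = true) ∨ (x = true ∧ y = false ∧ z = false) := by
  cases x <;> cases y <;> cases z <;> simp [splitCoeff] at h0 ⊢

/-- **Lee's differential changes the quantum degree by `0` or `4`.** For the Frobenius system
`R[X]/(X² - 1)` (`h = 0`, `t = 1`), a nonzero incidence number `⟨d s, s'⟩` forces
`qDegree s' = qDegree s` or `qDegree s' = qDegree s + 4`: writing `m' = m + Φ_m`,
`Δ' = Δ + Φ_Δ`, the maps `m`, `Δ` preserve the quantum degree and `Φ_m`, `Φ_Δ` raise it by
`4`. In particular Lee's differential is non-decreasing for the quantum filtration and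
preserves the quantum degree modulo `4`. Lee (2005), §4; Rasmussen (2010), §2.1,
Lemma 3.5. [cite: Rasmussen2010, Lemma 3.5] -/
theorem qDegree_eq_or_of_incidence_ne_zero {s s' : G.EnhancedState}
    (h0 : G.incidence R 0 1 s s' ≠ 0) :
    qDegree s' = qDegree s ∨ qDegree s' = qDegree s + 4 := by
  by_cases hex : ∃ i, s.state i = false ∧ s'.state = Function.update s.state i true
  swap
  · exact (h0 (incidence_of_not_flip R 0 1 hex)).elim
  obtain ⟨i, hi, hs'⟩ := hex
  rw [incidence_of_flip R 0 1 hi hs'] at h0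
  have hag : ∀ j, j ≠ i → s'.state j = s.state j := fun j hj ↦ by
    rw [hs', Function.update_of_ne hj]
  have hw : (s'.state.weight : ℤ) = s.state.weight + 1 := by
    rw [hs', State.weight_update hi]; push_cast; ring
  by_cases hm : G.IsMergeAt s.state i
  · rw [if_pos hm] at h0
    by_cases hlab : ∀ c, G.circleOf s'.state c ≠ G.circleOf s'.state (G.arcIn (G.overPos i)) →
        s'.label c = s.label c
    swap
    · exact (h0 (if_neg hlab)).elim
    rw [if_pos hlab] at h0
    have heq : G.circleOf s'.state (G.arcIn (G.overPos i)) =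
        G.circleOf s'.state (G.arcOut (G.overPos i)) := by
      by_contra h
      refine IsMergeAt.not_isSplitAt_holds hm ⟨hi, ?_⟩
      rwa [hs'] at h
    have key := qDegree_sub_weight_surgery hag hm.2 heq hlab
    rw [hw] at key
    rcases mergeCoeff_lee_ne_zero R (right_ne_zero_of_mul h0) with
      ⟨h1, h2, h3⟩ | ⟨h1, h2, h3⟩ | ⟨h1, h2, h3⟩ | ⟨h1, h2, h3⟩ <;>
    · simp only [h1, h2, h3, if_true, Bool.false_eq_true, if_false] at key
      omega
  · rw [if_neg hm] at h0
    by_cases hsp : G.IsSplitAt s.state i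
    swap
    · exact (h0 (if_neg hsp)).elim
    rw [if_pos hsp] at h0
    by_cases hlab : ∀ c, G.circleOf s.state c ≠ G.circleOf s.state (G.arcIn (G.overPos i)) →
        s'.label c = s.label c
    swap
    · exact (h0 (if_neg hlab)).elim
    rw [if_pos hlab] at h0
    have hne : G.circleOf s'.state (G.arcIn (G.overPos i)) ≠
        G.circleOf s'.state (G.arcOut (G.overPos i)) := by
      have h := hsp.2
      rwa [← hs'] at h
    have heq : G.circleOf s.state (G.arcIn (G.overPos i)) =
        G.circleOf s.state (G.arcOut (G.overPos i)) := by
      by_contra h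
      exact hm ⟨hi, h⟩
    have key := qDegree_sub_weight_surgery (fun j hj ↦ (hag j hj).symm) hne heq
      (fun x hx ↦ (hlab x hx).symm)
    rw [hw] at key
    rcases splitCoeff_lee_ne_zero R (right_ne_zero_of_mul h0) with
      ⟨h1, h2, h3⟩ | ⟨h1, h2, h3⟩ | ⟨h1, h2, h3⟩ | ⟨h1, h2, h3⟩ <;>
    · simp only [h1, h2, h3, if_true, Bool.false_eq_true, if_false] at key
      omega

/-- Lee's differential is **filtered**: a nonzero incidence number never lowers the quantum
degree. Rasmussen (2010), §2.1. [cite: Rasmussen2010, §2.1] -/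
theorem qDegree_le_of_incidence_ne_zero {s s' : G.EnhancedState}
    (h0 : G.incidence R 0 1 s s' ≠ 0) : qDegree s ≤ qDegree s' := by
  rcases qDegree_eq_or_of_incidence_ne_zero R h0 with h | h <;> omega

/-- Lee's differential **preserves the quantum degree modulo `4`** (the complex splits as a
direct sum according to `q mod 4`). Rasmussen (2010), Lemma 3.5. [cite: Rasmussen2010, Lemma 3.5] -/
theorem qDegree_modEq_of_incidence_ne_zero {s s' : G.EnhancedState}
    (h0 : G.incidence R 0 1 s s' ≠ 0) : qDegree s' ≡ qDegree s [ZMOD 4] := by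
  rcases qDegree_eq_or_of_incidence_ne_zero R h0 with h | h
  · rw [h]
  · rw [h, Int.ModEq]
    omega

end Ring

end GaussDiagram

end Literature.Topology.FourManifolds
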